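import Literature.MathematicalPhysics.QuantumFieldTheory.Balaban1983to89.B8Prop6CubeMemberGauged
import Literature.MathematicalPhysics.QuantumFieldTheory.Balaban1983to89.B8Prop6DentedCubeMemberGamma

/-!
# `Balaban1983to89.B8Prop6DentedCubeMemberGauged` — [Balaban1985RegularSpaces] PROPOSITION 6 (1.135)–(1.138) ∕ [Balaban1985Variational] (152)–(153) AT THE DENTED CUBE MEMBER:
# (1.137)'s identity ON THE BONDS OF `□^{(k)}` OVER `Ω_k` and the assembly `GaugedBoundB8D` from a gauge transformation with Theorem 4's clauses — dented twins of
# `B8Prop6CubeMemberEq137.eq137_cubeMember` (identity part) and `B8Prop6CubeMemberGauged.gaugedBoundB8_of_clauses` ((d3) MAP item (7), assembly half)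

statement-level skeleton of published theorems with citation tags; proofs where landed; nothing here is a claim about the
Yang–Mills mass gap

`[Balaban1985RegularSpaces]` ("B8" = [6], CMP **99** (1985) 75–102) Prop. 6 (1.135)–(1.138) p. 99, (1.37) p. 82, (1.29) p. 81, (1.128)–(1.129) p. 98, (1.132)–(1.133) p. 99; `[Balaban1985Averaging]`
(127) p. 37, (87) p. 31, (43) p. 24; `[Balaban1985Variational]` ("[15]", CMP **102** (1985) 277–309) (148)–(153) p. 301.  PDF held: `paper:balaban1985-cmp99-regular-spaces-gauge-fixing`,
`paper:balaban1985-cmp102-variational-background`.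

CITATION HEADER (lean-in-tree rule).  Cell `pub-ymgap` (HUMAN RULING D-0062, Track A), DAG node N05 = [B8], seat `pub-ymgap-dag-n05-e` (g31; row s3b, the (β) road; dag-n05-c standing GO
on dented twins I.42366).  WHY THIS FILE.  NODE 00's `GaugedBoundB8D` (p655171) reads (1.137)'s identity `Q_k(ηA) = log Ū₀′ᵏ` only on the bonds of `□^{(k)}` BOTH of whose `k`-blocks lie
in `Ω_k` (the level-`k` averages of `{Ω′_j}` live on `Λ′_k ⊆ Ω_k^{(k)}`).  The pure identity `B8Prop6CubeMemberEq137.logCovIter_eq_mlog_avgIter_cubeMember` runs (87) at the two ends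
of the bond, which lie in `Λ_k = □_k^{(k)}`; at the dented member the ends must lie in the dented cell `Λ′_k` — exactly the two `inTop` hypotheses of the clause.  The equality
`Ū₀″ᵏ = Ū₀′ᵏ` on `□^{(k)}` is locality of the averages ((43) of [3]) and needs NO «□ ⊂ Ω_k» (which the dented cube does not have); the pure file obtains it inside
`B8Prop6OfThm4.ineq137_cube` bundled with (1.137)'s inequality (which DOES use «□ ⊂ Ω_k»), so §1 isolates it.  §3 assembles `GaugedBoundB8D` from Theorem 4's clauses
exactly as `gaugedBoundB8_of_clauses` does for `GaugedBoundB8`.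

WHAT THIS MODULE PROVES (kernel, 0 sorry; `c : Node00.CubeB8D d L K Ω`; `𝔸` a non-trivial C⋆-algebra).
§1 `avgIter_cutFixed_eq_avgIter_axial` — `Ū₀″ᵏ(x, μ) = Ū₀′ᵏ(x, μ)` on the bonds of `□^{(k)}` (pure letters `a, M, ρ, k`; locality only); `under_or_under_of_inBox_bondBox` (the fine box of a
   level-`k` bond is the union of the two `k`-blocks).
§2 ★ `logCovIter_eq_mlog_avgIter_dentedMember` — (1.137)'s identity with `Ū₀″ᵏ` on the right at the DENTED member for the bonds `⟨x, x + e_μ⟩ ⊂ □^{(k)}` with `c.inTop x`,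
   `c.inTop (x + e_μ)` (twin of `logCovIter_eq_mlog_avgIter_cubeMember`: (1.29) w.r.t. `c.lamS`, (1.62)-shape on `SideTouches (c.sq c.k)`, datum `thm4_hypotheses_one_cutFixed_dented_γ`).
§3 ★★ `gaugedBoundB8D_of_clauses` — `GaugedBoundB8D L η U₀ c (7dL²(5dLB₀)Mα₀)` from a unitary `u` (= 1 off `□₀`) with (1.29) on `c.lamS`, (1.38) of record on `(c.sq 0, c.lamS)`,
   the sharp (1.62)-shape on the dented tower, `w = v⁻¹u` unitary and (1.135), the three norm members — (1.137) on the `Ω_k`-bonds by §2 + §1 at `A := mlogCfg c.k η c.sq …`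
   (`mlogCfg_spec`), the (1.62) constant weakened by `const_136`, assembled by `gaugedBoundB8D_intro`.
HONEST SCOPE.  By-name compositions; NO estimate; (1.137)'s INEQUALITY is not concluded at the dented member (it would need level-`k` plaquette bounds on all of `□`, i.e. «□ ⊂ Ω_k»;
`GaugedBoundB8D` does not ask it); nothing of [6]∕[15] asserted.  Count-neutral; N05 ∕ N07 NOT discharged; one finite `𝕋⁴` programme at fixed `ε`, Bałaban as printed; nothing
continuum ∕ ℝ⁴ ∕ OS ∕ mass-gap ∕ Clay.  No `sorry`, no `def`, no `instance`, no `notation`.  Unit `pub-ymgap-dag-n05-e` (g31), 2026-08-28.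
-/

noncomputable section

open NormedSpace

namespace Literature.MathematicalPhysics.QuantumFieldTheory.Balaban1983to89.B8Prop6DentedCubeMemberGauged

open Complex (I)
open MatrixLog B7Prop1Explicit B7Prop2Explicit B7Prop1Local B7Eq92Concrete
open B7Prop3Flat (expCfg c3)
open B7Prop4GeneralLevels (logCovIter)
open B7Prop5Flat (BondIn)
open B8Ineq130 (tlo thi gaugeAct_one)
open B8Ineq132 (InAk Under)
open B8Ineq133 (cutFixed cutCfg_agree avgIter_eq_of_agree)
open B8Eq115GaugeFixing (localGauge towerGauge gaugeAct_mul gaugeAct_agree gaugeAct_mem_of)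
open B8Eq146AExpansion (iEta)
open B8Eq184Proof (cfgExp)
open B8Eq140Level (SideTouches sideTouches_of_bondTouches)
open B8Eq119TwistedAxial (InAx Restr129)
open B8Eq131Derivation (eq87_of_inAx_restr129)
open B8Eq138LandauZd (IsLandau138W logCfg covLap)
open B8Eq131Cubes (bLo bHi box tLo tHi ctr tLo_eq tHi_eq le_of_margin_mono box_subset_cube_top)
open B8CubeMemberZd (cubeLamS_self)
open B8Prop6CubeMemberEq137 (logCovIter_one_eq_mlog_avgIter_loc_of_window mem_cubeLamS_top_of_sq mem_box_of_bondBox)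
open B8Prop6OfThm4 (const_136)
open B8LeafModelZd3 (mlogCfg mlogCfg_spec)
open B8Prop6DentedCubeMemberGamma (thm4_hypotheses_one_cutFixed_dented_γ)
open B8DentedCubeMemberZd (lamST_top)
open Node00 (CubeB8D GaugedBoundB8D gaugedBoundB8D_intro)

-- `Site` alone could resolve to the torus sites of `Setup.lean`; re-export the `ℤ^d` sites of `B7Prop1Explicit`.
export B7Prop1Explicit (Site)

variable {d : ℕ}

/-! ## §1 Locality: `Ū₀″ᵏ = Ū₀′ᵏ` on the bonds of `□^{(k)}`, and the fine box of a level-`k` bond -/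

section Locality

variable {𝔸 : Type} [CStarAlgebra 𝔸] [Nontrivial 𝔸]

omit [Nontrivial 𝔸] in
/-- **`Ū₀″ᵏ(x, μ) = Ū₀′ᵏ(x, μ)` ON THE BONDS OF `□^{(k)}`** (`U₀″ = U₀′` on `□̃ ⊃ Bᵏ(x) ∪ Bᵏ(x + e_μ)`; locality (43) of [3]): the equality half of `B8Prop6OfThm4.ineq137_cube`, which
needs NO «□ ⊂ Ω_k» (`L ≥ 2`). [cite: Balaban1985RegularSpaces, p.99 («equal to U₀′ on □̃»), (1.137) p.99; Balaban1985Averaging, p.24 (sentence after (43))] -/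
theorem avgIter_cutFixed_eq_avgIter_axial {L : ℕ} (hL : 2 ≤ L) (k : ℕ) (U₀ : Site d → Fin d → 𝔸ˣ) (a : Site d) {M : ℕ} (ρ : ℕ)
    (x : Site d) (μ : Fin d) (hx : bLo L a 0 0 ≤ x) (hx' : x + e μ ≤ bHi L a M 0 0) :
    avgIter L (cutFixed L (tLo a ρ) (tHi a M ρ) U₀ k (ctr a M)) k x μ =
      avgIter L (gaugeAct (localGauge L (tLo a ρ) (tHi a M ρ) U₀ k (ctr a M)) U₀) k x μ := by
  have hL1 : 1 ≤ L := le_trans (by norm_num) hL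
  set Uc := clampCfg (tlo L (tLo a ρ) k) (thi L (tHi a M ρ) k) U₀ with hUc
  have hagc : AgreeOn (tlo L (tLo a ρ) k) (thi L (tHi a M ρ) k) (gaugeAct (towerGauge L Uc k (ctr a M)) Uc)
      (gaugeAct (localGauge L (tLo a ρ) (tHi a M ρ) U₀ k (ctr a M)) U₀) :=
    gaugeAct_agree (clampCfg_agree U₀) _
  have hsub0 : tLo a ρ ≤ bLo L a 0 0 ∧ bHi L a M 0 0 ≤ tHi a M ρ := by
    rw [tLo_eq L, tHi_eq L]
    exact le_of_margin_mono (Nat.zero_le _)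
  have hxt : tlo L (tLo a ρ) 0 ≤ x := fun i => (hsub0.1 i).trans (hx i)
  have hxt' : x + e μ ≤ thi L (tHi a M ρ) 0 := fun i => (hx' i).trans (hsub0.2 i)
  have hag'' : AgreeOn (tlo L (tLo a ρ) k) (thi L (tHi a M ρ) k) (cutFixed L (tLo a ρ) (tHi a M ρ) U₀ k (ctr a M))
      (gaugeAct (towerGauge L Uc k (ctr a M)) Uc) :=
    fun z κ hz hz' => (cutCfg_agree _ _ _ z κ hz hz').trans (hagc.symm z κ hz hz')
  have e1 := avgIter_eq_of_agree hL1 hag'' (Nat.zero_le k) hxt hxt'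
  have e2 := avgIter_eq_of_agree hL1 hagc.symm (Nat.zero_le k) hxt hxt'
  rw [Nat.sub_zero] at e1 e2
  exact e1.trans e2.symm

omit [Nontrivial 𝔸] in
/-- **THE FINE BOX OF A LEVEL-`j` BOND IS THE UNION OF ITS TWO `j`-BLOCKS**: `InBox (loK L j z) (bondHiK L j z μ) x ⇒ x ∈ Bʲ(z) ∨ x ∈ Bʲ(z + e_μ)`.
[cite: Balaban1985Averaging, p.24 (sentence after (43)); Balaban1985RegularSpaces, (1.6) p.77] -/
theorem under_or_under_of_inBox_bondBox {L j : ℕ} {z : Site d} {μ : Fin d} {x : Site d} (hx : InBox (loK L j z) (bondHiK L j z μ) x) :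
    Under L j z x ∨ Under L j (z + e μ) x := by
  by_cases hκ : x μ + 1 ≤ (L : ℤ) ^ j * (z μ + 1)
  · refine Or.inl fun i => ?_
    obtain ⟨h1, h2⟩ := hx i
    simp only [loK, bondHiK] at h1 h2
    by_cases hi : i = μ
    · subst hi; exact ⟨h1, hκ⟩
    · rw [if_neg hi] at h2; constructor <;> linarith
  · refine Or.inr fun i => ?_
    obtain ⟨h1, h2⟩ := hx i
    simp only [loK, bondHiK] at h1 h2
    simp only [Pi.add_apply, e, Pi.single_apply]
    by_cases hi : i = μ
    · subst hi; simp only [if_true] at h2 ⊢; constructor <;> linarith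
    · rw [if_neg hi] at h2; rw [if_neg hi]; constructor <;> linarith

end Locality

/-! ## §2 (1.137)'s identity at the dented member, on the bonds of `□^{(k)}` over `Ω_k` -/

section Identity

variable {𝔸 : Type} [CStarAlgebra 𝔸] [Nontrivial 𝔸]

omit [Nontrivial 𝔸] in
/-- The two exponent-field spellings agree bondwise (private plumbing, as in `B8Prop6CubeMemberEq137`). [folklore] -/
private theorem expCfg_iEta_apply (η : ℝ) (A : Site d → Fin d → 𝔸) (x : Site d) (κ : Fin d) :
    expCfg (iEta η A) x κ = cfgExp η A x κ :=
  congrFun (congrFun (B8Prop3GaugeFixedKLevel.expCfg_iEta_eq_cfgExp η A) x) κ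

/-- ★ **THE IDENTITY OF (1.137) «Q_k(ηA) = (1∕i) log Ū₀″ᵏ» AT THE DENTED CUBE MEMBER, ON THE BONDS OF `□^{(k)}` WHOSE TWO `k`-BLOCKS LIE IN `Ω_k`** — the clause of
`GaugedBoundB8D` (with `Ū₀″ᵏ`; §1 turns it into `Ū₀′ᵏ`).  DATUM: the dented datum `c` (`□̃ ⊂ Ω_{k−1}`, `L ≤ ρ ≤ M`, `11d < M`), unitary `U₀ ∈ 𝔄_k({Ω_j}, α₀)` in the (1.130)-regime
(so `thm4_hypotheses_one_cutFixed_dented_γ` supplies (1.132)'s axial class for `U₀″` on the dented cells).  ON `u`, `A`: (1.29)∕(152) `Restr129 L c.k c.lamS 1 u`; `U₀″^{u⁻¹} = e^{iηA}`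
with `|A| ≤ α₂(Lᵏη)⁻¹` on the bonds of the plaquettes touching `Ω′_k = □_k ∩ Ω_k` ((1.62)-shape, top level); `16·131072(d+1)²α₂ ≤ 1`, `2α₂ ≤ c₃(d, L)`.  CONCLUSION: for every bond
`⟨x, x + e_μ⟩ ⊂ □^{(k)}` with `c.inTop x`, `c.inTop (x + e_μ)` (both `k`-blocks in `Ω_k`): `Q_k(1, iηA)(x, μ) = log Ū₀″ᵏ(x, μ)`.  PROOF = the pure one's: (87) at `x`, `x + e_μ ∈ Λ′_k`
(`eq87_of_inAx_restr129` on the dented cells), the fine box of the bond inside `□_k ∩ Ω_k` (its two blocks), and the generic tower-local identity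
`B8Prop6CubeMemberEq137.logCovIter_one_eq_mlog_avgIter_loc_of_window`. [cite: Balaban1985RegularSpaces, Prop. 6 (1.137) p.99, (1.37) p.82, (1.29) p.81, (1.132) p.99; Balaban1985Variational, (152)–(153) p.301; Balaban1985Averaging, (127) p.37, (87) p.31] -/
theorem logCovIter_eq_mlog_avgIter_dentedMember (hd2 : 2 ≤ d) {L : ℕ} (hL : 2 ≤ L) {K : ℕ} {Ω : ℕ → Set (Site d)} (c : CubeB8D d L K Ω)
    (U₀ : Site d → Fin d → 𝔸ˣ) (hU₀ : ∀ x κ, U₀ x κ ∈ unitaryUnits 𝔸) {α₀ : ℝ} (hα : 0 < α₀)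
    (hα3 : C0 d * (α₀ * (L : ℝ) ^ 2) ≤ 1 / 3) (hα2 : 2 * (α₀ * (L : ℝ) ^ 2) ≤ c2' d L)
    {η : ℝ} (hη : 0 < η) (hA : InAk L c.k η α₀ Ω U₀)
    (hsmall : 11 * (d : ℝ) ^ 2 * (L : ℝ) ^ 2 * α₀ + ((c.M : ℝ) + 4 * c.ρ) * d * (L : ℝ) ^ 2 * α₀ ≤ 1 / 6)
    (u : Site d → 𝔸ˣ) (h129 : Restr129 L c.k c.lamS (1 : Site d → Fin d → 𝔸ˣ) u)
    (A : Site d → Fin d → 𝔸) {α₂ : ℝ} (hα₂ : 0 ≤ α₂)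
    (h16 : 16 * (131072 * ((d : ℝ) + 1) ^ 2) * α₂ ≤ 1) (hc₃ : 2 * α₂ ≤ c3 d L)
    (h162 : ∀ (z : Site d) (ν : Fin d), SideTouches (c.sq c.k) z ν →
      gaugeAct u⁻¹ (cutFixed L (tLo c.a c.ρ) (tHi c.a c.M c.ρ) U₀ c.k (ctr c.a c.M)) z ν = cfgExp η A z ν ∧
        ‖A z ν‖ ≤ α₂ * ((L : ℝ) ^ c.k * η)⁻¹)
    (x : Site d) (μ : Fin d) (hx : bLo L c.a 0 0 ≤ x) (hx' : x + e μ ≤ bHi L c.a c.M 0 0) (hix : c.inTop x) (hix' : c.inTop (x + e μ)) :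
    logCovIter L (1 : Site d → Fin d → 𝔸ˣ) (iEta η A) c.k x μ =
      mlog ((avgIter L (cutFixed L (tLo c.a c.ρ) (tHi c.a c.M c.ρ) U₀ c.k (ctr c.a c.M)) c.k x μ : 𝔸ˣ) : 𝔸) := by
  have hL1 : 1 ≤ L := le_trans (by norm_num) hL
  have hd1 : 1 ≤ d := le_trans (by norm_num) hd2
  have hk : 1 ≤ c.k := c.one_le_k
  have hG : AvgClosed d L (unitaryUnits 𝔸) := avgClosed_unitaryUnits d L
  set U'' := cutFixed L (tLo c.a c.ρ) (tHi c.a c.M c.ρ) U₀ c.k (ctr c.a c.M) with hU''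
  have hgU : gaugeAct u (gaugeAct u⁻¹ U'') = U'' := by rw [← gaugeAct_mul, mul_inv_cancel, gaugeAct_one]
  -- (1.132)'s axial class for `U₀″` on the dented cells, and (87) at the sites of `Λ′_k`
  obtain ⟨-, -, -, hAx, -, -⟩ := thm4_hypotheses_one_cutFixed_dented_γ hL hd1 c U₀ hU₀ hα hα3 hα2 hη hA hsmall
  have hAx' : InAx L c.k c.lamS (1 : Site d → Fin d → 𝔸ˣ)
      (mgauge (1 : Site d → Fin d → 𝔸ˣ) u (gaugeAct u⁻¹ U'') * (1 : Site d → Fin d → 𝔸ˣ)) := by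
    rw [mgauge_one_left, hgU, ← lamST_top c]
    exact hAx c.k le_rfl
  have h87 := eq87_of_inAx_restr129 L hL1 c.k c.lamS (1 : Site d → Fin d → 𝔸ˣ) (gaugeAct u⁻¹ U'') u hAx' h129
  -- both ends are level-`k` DENTED cells: in `□_k^{(k)}` (indeed in `□^{(k)}`) with their blocks in `Ω_k`
  obtain ⟨hxΛ, hxΛ'⟩ := mem_cubeLamS_top_of_sq L c.a c.M c.ρ c.k hx hx'
  rw [cubeLamS_self] at hxΛ hxΛ'
  have hxD : x ∈ c.lamS c.k := (c.mem_lamS_top_iff x).2 ⟨hxΛ, hix⟩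
  have hxD' : x + e μ ∈ c.lamS c.k := (c.mem_lamS_top_iff (x + e μ)).2 ⟨hxΛ', hix'⟩
  have hm := h87 c.k le_rfl x hxD
  have hp := h87 c.k le_rfl (x + e μ) hxD'
  obtain ⟨j, hj⟩ : ∃ j, c.k = j + 1 := ⟨c.k - 1, by omega⟩
  -- on the fine box of the bond: `U₁ = e^{iηA}`, `‖iηA‖ ≤ α₂L^{−k}` (the box lies in `□_k ∩ Ω_k`)
  set b : ℝ := α₂ * ((L : ℝ) ^ c.k)⁻¹ with hb_def
  have hLpos : (0 : ℝ) < L := by exact_mod_cast hL1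
  have hb0 : 0 ≤ b := by positivity
  have hLb : (L : ℝ) ^ c.k * b = α₂ := by rw [hb_def]; field_simp
  haveI : Nontrivial (Fin d) := Fin.nontrivial_iff_two_le.mpr hd2
  have hsqk : ∀ z, InBox (loK L c.k x) (bondHiK L c.k x μ) z → z ∈ c.sq c.k := by
    intro z hz
    rw [c.sq_top]
    refine ⟨box_subset_cube_top L c.a c.M c.ρ c.k (mem_box_of_bondBox hL1 c.a c.M c.k hx hx' hz), ?_⟩
    rcases under_or_under_of_inBox_bondBox hz with h | h
    · exact hix z h
    · exact hix' z h
  have hbox : ∀ z ν, BondIn (loK L c.k x) (bondHiK L c.k x μ) z ν →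
      gaugeAct u⁻¹ U'' z ν = expCfg (iEta η A) z ν ∧ ‖iEta η A z ν‖ ≤ b := by
    intro z ν hz
    obtain ⟨κ, hκ⟩ := exists_ne ν
    obtain ⟨hW, hAz⟩ := h162 z ν (sideTouches_of_bondTouches hκ (Or.inl (hsqk z hz.1)))
    refine ⟨by rw [expCfg_iEta_apply]; exact hW, ?_⟩
    have hLj : (0 : ℝ) < (L : ℝ) ^ c.k := by positivity
    show ‖((I : ℂ) * η) • A z ν‖ ≤ b
    rw [norm_smul, norm_mul, Complex.norm_I, one_mul, Complex.norm_real, Real.norm_eq_abs, abs_of_pos hη, hb_def]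
    calc η * ‖A z ν‖ ≤ η * (α₂ * ((L : ℝ) ^ c.k * η)⁻¹) := mul_le_mul_of_nonneg_left hAz hη.le
      _ = α₂ * ((L : ℝ) ^ c.k)⁻¹ := by field_simp
  have hU₁E : AgreeOn (loK L c.k x) (bondHiK L c.k x μ) (gaugeAct u⁻¹ U'') (expCfg (iEta η A)) :=
    fun z ν hz hzν => (hbox z ν ⟨hz, hzν⟩).1
  have hB : ∀ z ν, BondIn (loK L c.k x) (bondHiK L c.k x μ) z ν → ‖iEta η A z ν‖ ≤ b :=
    fun z ν hz => (hbox z ν hz).2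
  rw [hj] at hU₁E hB hm hp hLb
  have key := logCovIter_one_eq_mlog_avgIter_loc_of_window L hL hG j x μ (iEta η A) hb0 hB (by rw [hLb]; exact h16)
    (by rw [hLb]; exact hc₃) u (gaugeAct u⁻¹ U'') hU₁E hm hp
  rw [hgU] at key
  rw [hj]
  exact key

end Identity

/-! ## §3 (1.135)–(1.138) as `GaugedBoundB8D` from a gauge transformation with Theorem 4's clauses -/

section Assembly

variable {𝔸 : Type} [CStarAlgebra 𝔸] [Nontrivial 𝔸]

/-- ★★ **(1.135)–(1.138) ∕ (152)–(153) AS `GaugedBoundB8D` AT EVERY DENTED CUBE, FROM A GAUGE TRANSFORMATION WITH THEOREM 4's CLAUSES** (twin of `gaugedBoundB8_of_clauses`): given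
the dented datum `c` in the (1.130)-regime, [3] Prop. 4's window `16·131072(d+1)²·α₂ ≤ 1`, `2α₂ ≤ c₃(d, L)` at `α₂ = 5dLB₀(L³α₀ + 6dL²Mα₀)`, a unitary `u` (= 1 off `□₀`) with (1.29)
on the dented cells, (1.38) of record on `(Ω′₀, Λ′)`, the sharp (1.62)-shape on the dented tower, `w = v⁻¹u` unitary and (1.135), and the three norm members with print's constant:
`GaugedBoundB8D L η U₀ c (7dL²(5dLB₀)Mα₀)` — (1.137)'s identity on the `Ω_k`-bonds of `□^{(k)}` by §2 + §1 at `A := mlogCfg c.k η c.sq …` (`mlogCfg_spec`), the (1.62) constant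
weakened by `const_136`, assembled by `gaugedBoundB8D_intro`. [cite: Balaban1985RegularSpaces, Prop. 6 (1.135)–(1.138) p.99, (1.62) p.87; Balaban1985Variational, (152)–(153) p.301] -/
theorem gaugedBoundB8D_of_clauses (hd2 : 2 ≤ d) {L : ℕ} (hL : 2 ≤ L) {B₀ : ℝ} (hB₀ : 0 < B₀) {η : ℝ} (hη : 0 < η) {K : ℕ}
    {Ω : ℕ → Set (Site d)} (c : CubeB8D d L K Ω) (U₀ : Site d → Fin d → 𝔸ˣ) (hU₀ : ∀ x κ, U₀ x κ ∈ unitaryUnits 𝔸) {α₀ : ℝ} (hα : 0 < α₀)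
    (hA : InAk L c.k η α₀ Ω U₀) (hα3 : C0 d * (α₀ * (L : ℝ) ^ 2) ≤ 1 / 3) (hα2 : 2 * (α₀ * (L : ℝ) ^ 2) ≤ c2' d L)
    (hsmall : 11 * (d : ℝ) ^ 2 * (L : ℝ) ^ 2 * α₀ + ((c.M : ℝ) + 4 * c.ρ) * d * (L : ℝ) ^ 2 * α₀ ≤ 1 / 6)
    (h16C : 16 * (131072 * ((d : ℝ) + 1) ^ 2) * (5 * (d : ℝ) * L * B₀ * ((L : ℝ) ^ 3 * α₀ + 6 * d * (L : ℝ) ^ 2 * c.M * α₀)) ≤ 1)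
    (hc3α : 2 * (5 * (d : ℝ) * L * B₀ * ((L : ℝ) ^ 3 * α₀ + 6 * d * (L : ℝ) ^ 2 * c.M * α₀)) ≤ c3 d L)
    (u : Site d → 𝔸ˣ) (hu : ∀ x, u x ∈ unitaryUnits 𝔸) (huS : ∀ x, x ∉ c.sq 0 → u x = 1)
    (h129 : Restr129 L c.k c.lamS (1 : Site d → Fin d → 𝔸ˣ) u)
    (hLan : IsLandau138W L c.k η (c.sq 0) c.lamS (1 : Site d → Fin d → 𝔸ˣ)
      (gaugeAct u⁻¹ (cutFixed L (tLo c.a c.ρ) (tHi c.a c.M c.ρ) U₀ c.k (ctr c.a c.M))))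
    (h162 : ∀ j, j ≤ c.k → ∀ b ∈ {b : Site d × Fin d | SideTouches (c.sq j) b.1 b.2},
      gaugeAct u⁻¹ (cutFixed L (tLo c.a c.ρ) (tHi c.a c.M c.ρ) U₀ c.k (ctr c.a c.M)) b.1 b.2 =
          cfgExp η (logCfg η (gaugeAct u⁻¹ (cutFixed L (tLo c.a c.ρ) (tHi c.a c.M c.ρ) U₀ c.k (ctr c.a c.M)))) b.1 b.2 ∧
        IsSelfAdjoint (logCfg η (gaugeAct u⁻¹ (cutFixed L (tLo c.a c.ρ) (tHi c.a c.M c.ρ) U₀ c.k (ctr c.a c.M))) b.1 b.2) ∧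
        ‖logCfg η (gaugeAct u⁻¹ (cutFixed L (tLo c.a c.ρ) (tHi c.a c.M c.ρ) U₀ c.k (ctr c.a c.M))) b.1 b.2‖ ≤
          (5 * (d : ℝ) * L * B₀ * ((L : ℝ) ^ 3 * α₀ + 6 * d * (L : ℝ) ^ 2 * c.M * α₀)) * ((L : ℝ) ^ j * η)⁻¹)
    (hw : ∀ x, ((localGauge L (tLo c.a c.ρ) (tHi c.a c.M c.ρ) U₀ c.k (ctr c.a c.M))⁻¹ * u) x ∈ unitaryUnits 𝔸)
    (h135 : AgreeOn (tlo L (tLo c.a c.ρ) c.k) (thi L (tHi c.a c.M c.ρ) c.k)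
      (gaugeAct ((localGauge L (tLo c.a c.ρ) (tHi c.a c.M c.ρ) U₀ c.k (ctr c.a c.M))⁻¹ * u)⁻¹ U₀)
      (gaugeAct u⁻¹ (cutFixed L (tLo c.a c.ρ) (tHi c.a c.M c.ρ) U₀ c.k (ctr c.a c.M))))
    (h136₂ : B8ScaledSupNorm.msup L c.k η (-(2 : ℝ)) (fun j (t : Fin d × Fin d × Site d) => SideTouches (c.sq j) t.2.2 t.2.1)
      (fun t => B8Ineq132.covDerivFwd η (1 : Site d → Fin d → 𝔸ˣ) t.1
        (fun z => mlogCfg c.k η c.sq (gaugeAct u⁻¹ (cutFixed L (tLo c.a c.ρ) (tHi c.a c.M c.ρ) U₀ c.k (ctr c.a c.M))) z t.2.1)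
        t.2.2) ≤ 7 * d * (L : ℝ) ^ 2 * (5 * (d : ℝ) * L * B₀) * c.M * α₀)
    (h136₃ : B8ScaledSupNorm.bondNorm L c.k η (-(3 : ℝ)) c.sq
      (fun x μ => B8Eq143PlaqExpansion.pdiv η (1 : Site d → Fin d → 𝔸ˣ) (B8Eq146AExpansion.plaqCovDeriv η (1 : Site d → Fin d → 𝔸ˣ)
        (mlogCfg c.k η c.sq (gaugeAct u⁻¹ (cutFixed L (tLo c.a c.ρ) (tHi c.a c.M c.ρ) U₀ c.k (ctr c.a c.M))))) μ x)
        ≤ 7 * d * (L : ℝ) ^ 2 * (5 * (d : ℝ) * L * B₀) * c.M * α₀)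
    (h136₄ : B8ScaledSupNorm.bondNorm L c.k η (-(3 : ℝ)) c.sq
      (fun x μ => B8Eq138LandauZd.covLap η (1 : Site d → Fin d → 𝔸ˣ)
        (fun z => mlogCfg c.k η c.sq (gaugeAct u⁻¹ (cutFixed L (tLo c.a c.ρ) (tHi c.a c.M c.ρ) U₀ c.k (ctr c.a c.M))) z μ) x)
        ≤ 7 * d * (L : ℝ) ^ 2 * (5 * (d : ℝ) * L * B₀) * c.M * α₀) :
    GaugedBoundB8D L η U₀ c (7 * d * (L : ℝ) ^ 2 * (5 * (d : ℝ) * L * B₀) * c.M * α₀) := by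
  have hL1 : 1 ≤ L := le_trans (by norm_num) hL
  have hd1 : 1 ≤ d := le_trans (by norm_num) hd2
  have hLpos : (0 : ℝ) < L := by exact_mod_cast hL1
  have hdpos : (0 : ℝ) < d := by exact_mod_cast hd1
  have hk : 1 ≤ c.k := c.one_le_k
  have hρ : 1 ≤ c.ρ := hL1.trans c.L_le_ρ
  have hM1 : 1 ≤ c.M := hρ.trans c.ρ_le_M
  have hMpos : (0 : ℝ) < c.M := by exact_mod_cast hM1
  have hM : 11 * (d : ℝ) < c.M := by exact_mod_cast c.big
  have hLdM : (L : ℝ) ≤ d * c.M := by exact_mod_cast c.L_le_dM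
  have hB0 : 0 < 5 * (d : ℝ) * L * B₀ := by positivity
  set α₂ : ℝ := 5 * (d : ℝ) * L * B₀ * ((L : ℝ) ^ 3 * α₀ + 6 * d * (L : ℝ) ^ 2 * c.M * α₀) with hα₂_def
  have hα₂0 : 0 ≤ α₂ := by positivity
  have h16 : 16 * α₂ ≤ 1 := by
    have hC1 : (1 : ℝ) ≤ 131072 * ((d : ℝ) + 1) ^ 2 := by nlinarith [sq_nonneg ((d : ℝ) + 1), hdpos]
    have : 16 * α₂ ≤ 16 * (131072 * ((d : ℝ) + 1) ^ 2) * α₂ := by nlinarith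
    exact this.trans h16C
  set U'' := cutFixed L (tLo c.a c.ρ) (tHi c.a c.M c.ρ) U₀ c.k (ctr c.a c.M) with hU''
  obtain ⟨hmem, -, -, -, -, -⟩ := thm4_hypotheses_one_cutFixed_dented_γ hL hd1 c U₀ hU₀ hα hα3 hα2 hη hA hsmall
  have hU₁u : ∀ x κ, gaugeAct u⁻¹ U'' x κ ∈ unitaryUnits 𝔸 := gaugeAct_mem_of hmem fun x => (unitaryUnits 𝔸).inv_mem (hu x)
  obtain ⟨-, hrep, -⟩ := mlogCfg_spec hη hL1 c.k (1 : Site d → Fin d → 𝔸ˣ) hU₁u hα₂0 h16 c.sq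
    (fun j hj y τ hsd => ⟨(h162 j hj (y, τ) hsd).1, (h162 j hj (y, τ) hsd).2.2⟩)
  have h162k : ∀ (z : Site d) (ν : Fin d), SideTouches (c.sq c.k) z ν →
      gaugeAct u⁻¹ U'' z ν = cfgExp η (mlogCfg c.k η c.sq (gaugeAct u⁻¹ U'')) z ν ∧
        ‖mlogCfg c.k η c.sq (gaugeAct u⁻¹ U'') z ν‖ ≤ α₂ * ((L : ℝ) ^ c.k * η)⁻¹ := fun z ν hsd =>
    ⟨(hrep c.k le_rfl z ν hsd).2, by rw [(hrep c.k le_rfl z ν hsd).1]; exact (h162 c.k le_rfl (z, ν) hsd).2.2⟩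
  have h137 : ∀ (x : Site d) (μ : Fin d), bLo L c.a 0 0 ≤ x → x + e μ ≤ bHi L c.a c.M 0 0 → c.inTop x → c.inTop (x + e μ) →
      logCovIter L (1 : Site d → Fin d → 𝔸ˣ)
          (iEta η (mlogCfg c.k η c.sq (gaugeAct u⁻¹ U''))) c.k x μ =
        mlog ((avgIter L (gaugeAct (localGauge L (tLo c.a c.ρ) (tHi c.a c.M c.ρ) U₀ c.k (ctr c.a c.M)) U₀) c.k x μ : 𝔸ˣ) : 𝔸) := by
    intro x μ hx hx' hix hix'
    rw [← avgIter_cutFixed_eq_avgIter_axial hL c.k U₀ c.a c.ρ x μ hx hx']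
    exact logCovIter_eq_mlog_avgIter_dentedMember hd2 hL c U₀ hU₀ hα hα3 hα2 hη hA hsmall u h129 _ hα₂0 h16C hc3α h162k x μ hx hx' hix hix'
  have h162' : ∀ j, j ≤ c.k → ∀ b ∈ {b : Site d × Fin d | SideTouches (c.sq j) b.1 b.2},
      gaugeAct u⁻¹ U'' b.1 b.2 = cfgExp η (logCfg η (gaugeAct u⁻¹ U'')) b.1 b.2 ∧ IsSelfAdjoint (logCfg η (gaugeAct u⁻¹ U'') b.1 b.2) ∧
        ‖logCfg η (gaugeAct u⁻¹ U'') b.1 b.2‖ ≤ (7 * d * (L : ℝ) ^ 2 * (5 * (d : ℝ) * L * B₀) * c.M * α₀) * ((L : ℝ) ^ j * η)⁻¹ := by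
    intro j hj b hb
    obtain ⟨h1, h2, h3⟩ := h162 j hj b hb
    refine ⟨h1, h2, h3.trans ?_⟩
    have hη0 : 0 ≤ ((L : ℝ) ^ j * η)⁻¹ := by positivity
    exact mul_le_mul_of_nonneg_right (const_136 hLpos hα hB0.le hLdM) hη0
  exact gaugedBoundB8D_intro L η U₀ c _ u hu huS h129 hLan h162' hw h135 h136₂ h136₃ h136₄ h137

#print axioms gaugedBoundB8D_of_clauses

end Assembly

end Literature.MathematicalPhysics.QuantumFieldTheory.Balaban1983to89.B8Prop6DentedCubeMemberGauged

end
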